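import Literature.AlgebraicGeometry.Motives.CorrespondencesAlgebraicOperators
import Literature.AlgebraicGeometry.Motives.CorrespondencesTraceFormula
import Literature.AlgebraicGeometry.Motives.CharpolyOfRationalTraces
import HarnessLib

/-!
# Discharged fact: `B(X)` is independent of the hyperplane class

`Literature.AlgebraicGeometry.Motives.Correspondences` records as a named fact (D-0014)
`WeilCohomology.standardConjectureB_iff_of_isHyperplaneClass : Prop` — for a Weil cohomology
theory `W` with the hard Lefschetz property, `X` smooth projective of dimension `n` and two
hyperplane classes `η`, `η'` on `X`, Grothendieck's standard conjecture of Lefschetz type `B(X)`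
(in `θ`-form: the inverses `θⁱ` of `Lⁿ⁻ⁱ : Hⁱ(X) ⥲ H²ⁿ⁻ⁱ(X)` are induced by algebraic
correspondences with `ℚ`-coefficients) holds for `η` iff it holds for `η'` (S. Kleiman,
*Algebraic cycles and the Weil conjectures* (1968), §2, with the trace formula 1.3.6; S. Kleiman,
*The standard conjectures* (1994), §4, remarks after Thm. 4-1; D. Lieberman, *Numerical and
homological equivalence of algebraic cycles on Hodge manifolds* (1968), the Cayley–Hamilton
argument; Y. André, *Une introduction aux motifs* (2004), §5.2). This file **proves** it
(`WeilCohomology.standardConjectureB_iff_of_isHyperplaneClass_holds`).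

## The argument (formal in the axioms of `WeilCohomology`, given hard Lefschetz)

Assume `B(X, η)` and fix `i ≤ n`, `r = n - i`, `j = 2n - i`; let `θ = θⁱ_η : Hʲ(X) → Hⁱ(X)` be
the algebraic inverse of `Lⁿ⁻ⁱ_η`.
1. `πⁱ = θ ∘ Lⁿ⁻ⁱ_η = id_{Hⁱ}` is algebraic (`isAlgebraicOperator_id_of_isLefschetzTheta`: twisting
   the correspondence of `θ` by `pr₁* ηⁿ⁻ⁱ`; hyperplane classes are algebraic).
2. `w = θ ∘ Lⁿ⁻ⁱ_{η'} : Hⁱ(X) → Hⁱ(X)` is algebraic (`IsAlgebraicOperator.comp_lefschetzPow`) and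
   bijective (hard Lefschetz for `η'`).
3. All powers `wᵐ` are algebraic (`IsAlgebraicOperator.pow`, composition of algebraic
   correspondences `isAlgebraicGradedOp_comp_holds`), so `Tr (wᵐ) ∈ ℚ` by the Lefschetz trace
   formula (`exists_rat_trace_of_isAlgebraicOperator`: `Tr (g) = ± tr_{X×X} (u_g ∪ [Δ])`, a
   rational number since `u_g`, `[Δ]` are rational algebraic classes).
4. Hence `χ_w ∈ ℚ[t]` (Newton's identities) and `w⁻¹ = ∑ qₘ wᵐ` with `qₘ ∈ ℚ` (Cayley–Hamilton,
   `LinearMap.exists_inverse_eq_sum_ratCast_smul_pow`); `∑ qₘ wᵐ` is algebraic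
   (`IsAlgebraicOperator.sum_ratCast_smul`).
5. `θⁱ_{η'} = w⁻¹ ∘ θ` is the two-sided inverse of `Lⁿ⁻ⁱ_{η'}` and is algebraic
   (`IsAlgebraicOperator.comp`). By symmetry, `B(X, η) ⇔ B(X, η')`.

Depends only on (fields of `WeilCohomology`): the hypothesis `W.HasHardLefschetz` (for `η'` resp.
`η`), `finite_obj`, `subsingleton_obj`, `isPerfPair_cupPairing`, `bijective_kunnethMap`,
`trace_externalCup`, `cup_assoc`, `cup_comm`, `one_cup`, `map_cup`, `trace_cycleClass`,
`cup_mem_ratAlgebraicClasses`, `pullback_ratAlgebraicClasses_le`, `exists_isInducedBy_id`,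
`exists_isInducedBy_pullback`, `map_ratAlgebraicClasses_of_isInducedBy` (the last two through
`isAlgebraicGradedOp_comp_holds`), and the discharged facts `IsSmoothProjective.tensor_holds`,
`isSmoothProjective_projectiveSpace_holds`.

## References

* S. Kleiman, *Algebraic cycles and the Weil conjectures*, in: Dix exposés sur la cohomologie des
  schémas, North-Holland (1968), 359–386, Prop. 1.3.6 and §2. [Kleiman1968AlgebraicCycles]
* S. Kleiman, *The standard conjectures*, Proc. Sympos. Pure Math. 55 (1994), 3–20, §4.
  [Kleiman1994]
* D. Lieberman, *Numerical and homological equivalence of algebraic cycles on Hodge manifolds*,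
  Amer. J. Math. 90 (1968), 366–374.
* Y. André, *Une introduction aux motifs*, Panoramas et Synthèses 17 (2004), §5.2. [Andre2004]
-/

universe u v

open CategoryTheory AlgebraicGeometry MonoidalCategory CartesianMonoidalCategory Opposite
open scoped TensorProduct

noncomputable section

namespace Literature.AlgebraicGeometry.Motives

namespace WeilCohomology

variable {k : Type u} [Field k] {K : Type v} [Field K] [CharZero K] (W : WeilCohomology k K)
variable {n : ℕ} {X : SchemeOver k}

/-- **Transfer of `B(X)` from one hyperplane class to another** (Kleiman 1968 §2; Kleiman 1994
§4; Lieberman 1968): under hard Lefschetz, if `B(X)` holds in `θ`-form for the hyperplane class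
`η`, then it holds for the hyperplane class `η'`: with `θ = θⁱ_η` algebraic,
`w = θ ∘ Lⁿ⁻ⁱ_{η'}` is an algebraic automorphism of `Hⁱ(X)` whose powers have rational traces
(Lefschetz trace formula), so `w⁻¹ ∈ ℚ[w]` (Cayley–Hamilton) is algebraic and
`θⁱ_{η'} = w⁻¹ ∘ θ`. [cite: Kleiman1968AlgebraicCycles, §2 (with Prop. 1.3.6)] -/
theorem standardConjectureB_of_standardConjectureB (hL : W.HasHardLefschetz)
    (hX : IsSmoothProjective n X) {η η' : W.obj X 2} (hη : W.IsHyperplaneClass X η)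
    (hη' : W.IsHyperplaneClass X η') (hB : W.StandardConjectureB n X η) :
    W.StandardConjectureB n X η' := by
  intro i r j h₁ h₂
  obtain ⟨θ, hθ, halg⟩ := hB i r j h₁ h₂
  -- 1. `πⁱ = θ ∘ Lⁿ⁻ⁱ_η = id` is algebraic
  have hid : W.IsAlgebraicOperator n n (LinearMap.id : W.obj X i →ₗ[K] W.obj X i) :=
    W.isAlgebraicOperator_id_of_isLefschetzTheta hX hη hθ halg
  -- 2. `w = θ ∘ Lⁿ⁻ⁱ_{η'}` is an algebraic automorphism of `Hⁱ(X)`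
  have hbij : Function.Bijective (W.lefschetzPow X η' r i j h₂) := hL hX η' hη' i r j h₁ h₂
  set w : W.obj X i →ₗ[K] W.obj X i := θ ∘ₗ W.lefschetzPow X η' r i j h₂ with hw
  have walg : W.IsAlgebraicOperator n n w := halg.comp_lefschetzPow hX hX hη' h₂
  have hθbij : Function.Bijective θ :=
    Function.bijective_iff_has_inverse.mpr ⟨W.lefschetzPow X η r i j h₂,
      fun y ↦ LinearMap.congr_fun hθ.2.2 y, fun x ↦ LinearMap.congr_fun hθ.2.1 x⟩
  have hunit : IsUnit w := (Module.End.isUnit_iff w).mpr (hθbij.comp hbij)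
  -- 3. the powers of `w` are algebraic, hence have rational traces
  haveI := W.finite_obj hX i
  have htr : ∀ m : ℕ, ∃ q : ℚ, LinearMap.trace K _ (w ^ (m + 1)) = q := fun m ↦
    W.exists_rat_trace_of_isAlgebraicOperator hX (walg.pow hX hid (m + 1))
  -- 4. `w⁻¹ = ∑ qₘ wᵐ`, `qₘ ∈ ℚ`, is algebraic
  obtain ⟨q, hv, -⟩ := LinearMap.exists_inverse_eq_sum_ratCast_smul_pow w hunit htr
  set v : W.obj X i →ₗ[K] W.obj X i :=
    ∑ m ∈ Finset.range (Module.finrank K (W.obj X i)), ((q m : ℚ) : K) • w ^ m with hv'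
  have valg : W.IsAlgebraicOperator n n v :=
    PreWeilCohomology.IsAlgebraicOperator.sum_ratCast_smul _ q fun m _ ↦ walg.pow hX hid m
  -- 5. `θ' = w⁻¹ ∘ θ` is the algebraic inverse of `Lⁿ⁻ⁱ_{η'}`
  have hleft : (v ∘ₗ θ) ∘ₗ W.lefschetzPow X η' r i j h₂ = LinearMap.id := by
    rw [LinearMap.comp_assoc, ← hw, ← Module.End.mul_eq_comp, hv, Module.End.one_eq_id]
  refine ⟨v ∘ₗ θ, ⟨h₁, hleft, ?_⟩, valg.comp hX hX hX halg⟩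
  refine LinearMap.ext fun y ↦ ?_
  obtain ⟨x, rfl⟩ := hbij.2 y
  have hx := LinearMap.congr_fun hleft x
  simp only [LinearMap.comp_apply, LinearMap.id_apply] at hx ⊢
  rw [hx]

/-- **`B(X)` is independent of the hyperplane class** — discharge of the named fact
`WeilCohomology.standardConjectureB_iff_of_isHyperplaneClass` (Kleiman 1968 §2 with the
Lefschetz trace formula Prop. 1.3.6; Kleiman 1994 §4, remarks following Thm. 4-1; André 2004
§5.2): under hard Lefschetz, for `X` smooth projective of dimension `n` and hyperplane classes
`η`, `η'`, `B(X)` for `η` holds iff `B(X)` for `η'` holds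
(`standardConjectureB_of_standardConjectureB` in both directions). [cite: Kleiman1968AlgebraicCycles, §2 (with Prop. 1.3.6)] -/
theorem standardConjectureB_iff_of_isHyperplaneClass_holds :
    standardConjectureB_iff_of_isHyperplaneClass (W := W) (n := n) (X := X) :=
  fun hL hX _ _ hη hη' ↦ ⟨W.standardConjectureB_of_standardConjectureB hL hX hη hη',
    W.standardConjectureB_of_standardConjectureB hL hX hη' hη⟩

end WeilCohomology

end Literature.AlgebraicGeometry.Motives

end
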